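import Summits.QuantumFields.GaugeBoot.Eqs.BindKitZ
import HarnessLib

/-!
# Binding kit, integer check PARTITIONED by label-code residue classes (`BindZ.cchkZP`)

Cell `pub-gaugeboot` (HOME `run/shared/lean/pub/pub-gaugeboot/`), seat lean2 (binding engine; sequel of `Eqs/BindKitZ`).
`Eqs/BindKitZ.cchkZ` certifies ONE coded equality row `(terms, M, K, witness)` by comparing the merge-sort canonical forms of
`K • terms` and of the witness combination `Σ_j m_j • evalZ p q (litZ j)` of the family's literal theorem rows.  For the
AGGREGATED rows of large families (kz-L2-rp-4D: one row of ≈ 10⁴ terms combining ≈ 3·10³ literal rows of the 3 659 G1 rows)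
a single comparison exceeds the gate's per-module budget.  This kit splits the SAME comparison into `m` independent ones:
* `ZRow.cls m i r` keeps the terms of `r` whose label code is `≡ i (mod m)`; `zval r = Σ_{i<m} zval (cls m i r)` (`zval_sum_cls`);
* `cchkZP litZ p q m i c` = `K ≠ 0 ∧ mcanon (cls m i (K • terms)) = mcanon (cls m i (Σ_j m_j • evalZ p q (litZ j)))` — class `i` only;
* `rowVal_decWZ_eq_zero_of_cchkZP` — SOUNDNESS for any valuation `W : Word d → ℝ`: if every decoded literal row vanishes under `W`
  at `β₀ = p/q` (`q ≠ 0`), `0 < m`, and the class checks pass for ALL `i < m`, the decoded problem row `decWZ d terms M` vanishes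
  under `W` at `β₀`.  The `m` class checks are closed Boolean computations that may live in DIFFERENT modules; the row's term list
  and witness may themselves be assembled from pieces (`++`) defined in several data modules.
Nothing here is a certificate replay; positivity blocks are not treated.

HONEST FRAMING (page 1 of every file of this cell): certified bounds on lattice expectations at STATED coupling, gauge
group, dimension and torus size; NOT a mass gap, NOT a continuum limit, NOT a string tension, NOT large `N`; NOT
Yang–Mills-summit-bearing (barriers `FixedCouplingUltralocality`, `PerturbativeInvisibility`).
-/

noncomputable section

open Literature.MathematicalPhysics.QuantumFieldTheory
open Summit.QuantumFields.GaugeBoot.BindN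

namespace Summit.QuantumFields.GaugeBoot.BindZ

/-! ## Residue classes of label codes -/

/-- The terms of an integer row whose label code is `≡ i (mod m)`. -/
def ZRow.cls (m i : ℕ) (r : ZRow) : ZRow := r.filter fun t => t.1 % m = i

variable (v : ℕ → ℝ)

/-- Unfolding lemma. -/
@[simp] theorem cls_nil (m i : ℕ) : ZRow.cls m i [] = [] := rfl

/-- Unfolding lemma. -/
theorem cls_cons (m i : ℕ) (t : ℕ × ℤ) (r : ZRow) :
    ZRow.cls m i (t :: r) = if t.1 % m = i then t :: ZRow.cls m i r else ZRow.cls m i r := by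
  simp only [ZRow.cls, List.filter_cons, decide_eq_true_eq]

/-- **The classes partition the value**: `Σ_{i<m} zval (cls m i r) = zval r` (`0 < m`). -/
theorem zval_sum_cls (m : ℕ) (hm : 0 < m) (r : ZRow) :
    ∑ i ∈ Finset.range m, zval v (ZRow.cls m i r) = zval v r := by
  induction r with
  | nil => simp
  | cons t r ih =>
    have hmem : t.1 % m ∈ Finset.range m := Finset.mem_range.2 (Nat.mod_lt _ hm)
    have hsplit : ∀ i ∈ Finset.range m,
        zval v (ZRow.cls m i (t :: r)) = (if t.1 % m = i then (t.2 : ℝ) * v t.1 else 0) + zval v (ZRow.cls m i r) := by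
      intro i _
      rw [cls_cons]
      split_ifs with h
      · rw [zval_cons]
      · rw [zero_add]
    rw [Finset.sum_congr rfl hsplit, Finset.sum_add_distrib, ih, Finset.sum_ite_eq, if_pos hmem, zval_cons]

/-! ## The partitioned check -/

/-- **Class `i` (of `m`) of the integer kernel check at `β = p/q`**: `K ≠ 0` and the canonical forms of the class-`i` parts of
`K • terms` and of the witness combination of the evaluated literal rows agree. -/
def cchkZP (litZ : ℕ × ℕ → LitZ) (p q : ℤ) (m i : ℕ) (c : CRowZ) : Bool :=
  (c.2.2.1 != 0) &&
    decide (ZRow.mcanon (ZRow.cls m i (ZRow.smul c.2.2.1 c.1)) =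
      ZRow.mcanon (ZRow.cls m i (ZRow.lincomb (comboZ litZ p q c.2.2.2))))

variable {d : ℕ} [NeZero d] (W : Word d → ℝ)

/-- **Soundness of the partitioned check, any valuation**: if every decoded literal row vanishes under `W` at `β₀ = p/q`
(`q ≠ 0`), `0 < m`, and the coded row `c` passes `cchkZP litZ p q m i` for every `i < m`, then its decoded row
`decWZ d c.1 c.2.1` vanishes under `W` at `β₀`. -/
theorem rowVal_decWZ_eq_zero_of_cchkZP (litZ : ℕ × ℕ → LitZ) (β₀ : ℚ) (p q : ℤ) (hq : q ≠ 0) (hβ : (p : ℚ) / q = β₀)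
    (hlit : ∀ i, rowVal (β₀ : ℝ) W (decRowQ d (litQ (litZ i))) = 0) (m : ℕ) (hm : 0 < m) (c : CRowZ)
    (h : ∀ i < m, cchkZP litZ p q m i c = true) : rowVal (β₀ : ℝ) W (decWZ d c.1 c.2.1) = 0 := by
  have hK : c.2.2.1 ≠ 0 := by
    have h0 := h 0 hm
    simp only [cchkZP, Bool.and_eq_true, bne_iff_ne, ne_eq, decide_eq_true_eq] at h0
    exact h0.1
  -- class by class, the two sides have equal values
  have hcls : ∀ i ∈ Finset.range m,
      zval (fun n => W (wdg d n)) (ZRow.cls m i (ZRow.smul c.2.2.1 c.1)) =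
        zval (fun n => W (wdg d n)) (ZRow.cls m i (ZRow.lincomb (comboZ litZ p q c.2.2.2))) := by
    intro i hi
    have hi' := h i (Finset.mem_range.1 hi)
    simp only [cchkZP, Bool.and_eq_true, bne_iff_ne, ne_eq, decide_eq_true_eq] at hi'
    exact zval_eq_of_mcanon_eq _ _ _ hi'.2
  have hval : zval (fun n => W (wdg d n)) (ZRow.smul c.2.2.1 c.1) =
      zval (fun n => W (wdg d n)) (ZRow.lincomb (comboZ litZ p q c.2.2.2)) := by
    rw [← zval_sum_cls _ m hm, ← zval_sum_cls _ m hm (ZRow.lincomb _)]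
    exact Finset.sum_congr rfl hcls
  rw [zval_smul, zval_lincomb_eq_zero] at hval
  · have hz : zval (fun n => W (wdg d n)) c.1 = 0 := by
      rcases mul_eq_zero.1 hval with h0 | h0
      · exact absurd (by exact_mod_cast h0) hK
      · exact h0
    rw [rowVal_decWZ, hz, zero_div]
  · intro e he
    obtain ⟨x, _, rfl⟩ := List.mem_map.1 he
    show zval (fun n => W (wdg d n)) (evalZ p q (litZ x.2)) = 0
    rw [zval_evalZ _ β₀ p q hq hβ, rowVal_decRowQ, hlit x.2, mul_zero]

/-- Example (closed computation): the `BindKitZ` example row split into `m = 2` classes by code parity — class `0`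
(codes `0`, `1324`) carries everything, class `1` is empty on both sides; both class checks pass. -/
example : cchkZP (fun _ => [ez 0 4 0, ez 1324 0 (-1)]) 3 2 2 0 ([tz 1324 3, tz 0 (-16)], 7, 4, [lz (-1) 0 0]) = true ∧
    cchkZP (fun _ => [ez 0 4 0, ez 1324 0 (-1)]) 3 2 2 1 ([tz 1324 3, tz 0 (-16)], 7, 4, [lz (-1) 0 0]) = true := by
  constructor <;> decide +kernel

end Summit.QuantumFields.GaugeBoot.BindZ

end
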